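import Mathlib
import Literature.AlgebraicGeometry.Resolution.BlowupChartRsop

/-!
# The `μ_p` cones `(1/p)(w) × 𝔸^c`, all `p`: definitions (weight-`0` subalgebra, Veronese vertex generators)
(crux stmt-ResolutionOfSingularities-15640 `WildQuotients.WildQuotientResolution`, line `Sketch`;
chain w45c POST-V5 S2-P2 = `ConductorOneCore p n` of bricks (res-L1-w45c-plan-1 RULINGs
2026-08-27T16:07:22Z (B) / 16:20:20Z (2): the residual points of the conductor-one core after the
norm-base blow-up are the toric `μ_p`-points `(1/p)(+1 on I, −1 off I)` (idea-2 card
`conductor-one-kummer-core` (3)); `μ_p` is INFINITESIMAL in characteristic `p`, so the local model is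
the weight-`0` MONOMIAL SUBALGEBRA, not a fixed-point ring). This file is `…ThirdConeDefs`
(res-L1-w45c-stub-2, T3) with `ZMod 3 ↦ ZMod p`, decl for decl, for the VERONESE type (all
non-passenger weights `= 1`); the accepted `ThirdCone` files are deliberately NOT edited.
[OURS · L1 W4.5c] — NOT a statement of any manuscript; replaces the role of no printed item.
Owner res-L1-w45c-stub-4 (gen 4; successor files the blow-up theorem `…PthConeVeronese`).)

For `p : ℕ` and a weight `w : Fin n → ZMod p` (weight `1` = the `a` cone variables, weight `0` = the
`c` passengers for the Veronese type `(a,0)`; general `w` allowed in the definitions):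
* `PthCone.cone k n p w` — the weight-`0` subalgebra of `k[x₁,…,x_n]`;
* `PthCone.VIdx n p w` — index type of the VERONESE VERTEX GENERATORS: exponent vectors
  `d : Fin n → Fin (p+1)` supported on the weight-`1` variables with `∑ dᵢ = p` (the degree-`p`
  monomials in the weight-`1` variables);
* `PthCone.vertexExp`, `PthCone.vertexGen k n p w : VIdx n p w → cone`, `PthCone.vertexFamily` (re-indexed
  by `Fin _`, the format of `Literature…chartRing` / `JordanThree.isRegular_affineBlowup_of_charts`),
  `PthCone.vertexIdeal k n p w := Ideal.span (Set.range (vertexFamily k n p w))`.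
No notation (plan-1 §6 (30)).
-/

-- single-problem summit: the doubled namespace component `ResolutionOfSingularities` is forced
set_option linter.dupNamespace false

noncomputable section

open MvPolynomial

namespace Summit.ResolutionOfSingularities.ResolutionOfSingularities.Theorems.WildQuotientResolution.PthCone

variable (k : Type) [Field k] (n p : ℕ) (w : Fin n → ZMod p)

/-- **The cone `(1/p)(w)`**: the subalgebra of `k[x₁,…,x_n]` of polynomials all of whose monomials
`x^d` have weight `∑ dᵢ wᵢ = 0` in `ZMod p`. [OURS · L1 W4.5c] -/
def cone : Subalgebra k (MvPolynomial (Fin n) k) where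
  carrier := {f | IsWeightedHomogeneous w f 0}
  mul_mem' {f g} hf hg := by simpa using hf.mul hg
  one_mem' := isWeightedHomogeneous_one k w
  add_mem' {f g} hf hg := hf.add hg
  zero_mem' := isWeightedHomogeneous_zero k w 0
  algebraMap_mem' r := isWeightedHomogeneous_C w r

/-- Membership in the cone is weighted homogeneity of weight `0`. [OURS · L1 W4.5c] -/
theorem mem_cone_iff (f : MvPolynomial (Fin n) k) :
    f ∈ cone k n p w ↔ IsWeightedHomogeneous w f 0 :=
  Iff.rfl

/-- A monomial lies in the cone iff its exponent has weight `0` (or its coefficient vanishes).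
[OURS · L1 W4.5c] -/
theorem monomial_mem_cone {d : Fin n →₀ ℕ} (hd : Finsupp.weight w d = 0) (r : k) :
    monomial d r ∈ cone k n p w :=
  isWeightedHomogeneous_monomial w d r hd

/-- **Index type of the Veronese vertex generators**: exponent vectors `d` with entries `≤ p`,
supported on the weight-`1` variables, of total degree `p`. [OURS · L1 W4.5c] -/
abbrev VIdx : Type :=
  {d : Fin n → Fin (p + 1) // (∑ i, (d i : ℕ)) = p ∧ ∀ i, w i ≠ 1 → d i = 0}

/-- The exponent vector of a vertex generator, as a finitely supported function. [OURS · L1 W4.5c] -/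
def vertexExp (v : VIdx n p w) : Fin n →₀ ℕ :=
  Finsupp.equivFunOnFinite.symm fun i => (v.1 i : ℕ)

/-- `vertexExp v i = v i`. [OURS · L1 W4.5c] -/
@[simp] theorem vertexExp_apply (v : VIdx n p w) (i : Fin n) : vertexExp n p w v i = (v.1 i : ℕ) :=
  rfl

/-- Every Veronese vertex exponent has weight `0`: `∑ dᵢ wᵢ = ∑ dᵢ · 1 = p = 0` in `ZMod p`.
[OURS · L1 W4.5c] -/
theorem weight_vertexExp (v : VIdx n p w) : Finsupp.weight w (vertexExp n p w v) = 0 := by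
  rw [Finsupp.weight_apply, Finsupp.sum_fintype _ _ (fun i => by simp)]
  have hterm : ∀ i, (vertexExp n p w v i) • w i = ((v.1 i : ℕ) : ZMod p) := by
    intro i
    rw [vertexExp_apply, nsmul_eq_mul]
    by_cases hi : w i = 1
    · rw [hi, mul_one]
    · rw [v.2.2 i hi]; simp
  simp_rw [hterm]
  rw [← Nat.cast_sum, v.2.1, ZMod.natCast_self]

/-- **The Veronese vertex generators** `x^d` (`d ∈ VIdx`), as elements of the cone. [OURS · L1 W4.5c] -/
def vertexGen (v : VIdx n p w) : cone k n p w :=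
  ⟨monomial (vertexExp n p w v) 1, monomial_mem_cone k n p w (weight_vertexExp n p w v) 1⟩

/-- The vertex generators re-indexed by `Fin _`. [OURS · L1 W4.5c] -/
def vertexFamily : Fin (Fintype.card (VIdx n p w)) → cone k n p w :=
  vertexGen k n p w ∘ (Fintype.equivFin (VIdx n p w)).symm

/-- **The Veronese vertex ideal** of the cone: the ideal generated by the degree-`p` monomials in
the weight-`1` variables. [OURS · L1 W4.5c] -/
def vertexIdeal : Ideal (cone k n p w) :=
  Ideal.span (Set.range (vertexFamily k n p w))

/-- `vertexFamily` and `vertexGen` have the same range. [OURS · L1 W4.5c] -/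
theorem range_vertexFamily : Set.range (vertexFamily k n p w) = Set.range (vertexGen k n p w) :=
  EquivLike.range_comp _ _

/-- `vertexFamily (equivFin v) = vertexGen v`. [OURS · L1 W4.5c] -/
theorem vertexFamily_equivFin (v : VIdx n p w) :
    vertexFamily k n p w (Fintype.equivFin (VIdx n p w) v) = vertexGen k n p w v := by
  simp [vertexFamily]

/-- The value of a vertex generator as a polynomial. [OURS · L1 W4.5c] -/
theorem coe_vertexGen (v : VIdx n p w) :
    ((vertexGen k n p w v : cone k n p w) : MvPolynomial (Fin n) k) = monomial (vertexExp n p w v) 1 :=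
  rfl

/-- The pure power index `p · e_z` of a weight-`1` variable `z`. [OURS · L1 W4.5c] -/
def pureIdx (z : Fin n) (hz : w z = 1) : VIdx n p w :=
  ⟨fun i => if i = z then Fin.last p else 0, by
    refine ⟨?_, fun i hi => ?_⟩
    · rw [Finset.sum_eq_single z (fun i _ hi => by simp [hi]) (by simp)]
      simp
    · have : i ≠ z := fun h => hi (h ▸ hz)
      simp [this]⟩

/-- The exponent of the pure power index is `p · e_z`. [OURS · L1 W4.5c] -/
theorem vertexExp_pureIdx (z : Fin n) (hz : w z = 1) :
    vertexExp n p w (pureIdx n p w z hz) = Finsupp.single z p := by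
  ext i
  rw [vertexExp_apply, Finsupp.single_apply]
  by_cases h : i = z
  · subst h; simp [pureIdx]
  · rw [if_neg (Ne.symm h)]; simp [pureIdx, h]

/-- The pure power generator is `x_z^p`. [OURS · L1 W4.5c] -/
theorem coe_vertexGen_pureIdx (z : Fin n) (hz : w z = 1) :
    ((vertexGen k n p w (pureIdx n p w z hz) : cone k n p w) : MvPolynomial (Fin n) k) = X z ^ p := by
  rw [coe_vertexGen, vertexExp_pureIdx, X_pow_eq_monomial]

/-- Any vertex index has a variable with positive exponent, as soon as `0 < p`. [OURS · L1 W4.5c] -/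
theorem exists_pos_of_vIdx (hp : 0 < p) (v : VIdx n p w) : ∃ z, w z = 1 ∧ 0 < (v.1 z : ℕ) := by
  by_contra h
  push Not at h
  have hzero : ∀ i, (v.1 i : ℕ) = 0 := fun i => by
    by_cases hi : w i = 1
    · exact Nat.le_zero.mp (h i hi)
    · rw [v.2.2 i hi]; rfl
  have := v.2.1
  simp only [hzero, Finset.sum_const_zero] at this
  omega

end Summit.ResolutionOfSingularities.ResolutionOfSingularities.Theorems.WildQuotientResolution.PthCone

end
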